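import Mathlib

/-!
# Hodge-locus census (pub-hlocus, engine A, abs-1 gen 39) — kernel anchors for DERIVATION-GK-A §5r
# (K-CONG for composite `m′` from genus theory and Rédei–Reichardt; PREREG-PARTK-A §K-GENUS, §K-GENUS-EVEN)

certified instances and evidence bearing on the general Hodge conjecture; no claim.

§5r proves the classical congruence K-CONG(m′): `ε̄^(2h′)·w̄^(h/2) = 1` in `𝔽₉` (odd `D = −3m′`), and its even
companion `ε̄^(2h′)·(−w̄)^(h/2) = (−1)^[m prime]` (`D = −12m`), for every COMPOSITE `m′` (resp. every `m`), from:
genus theory (2-ranks), the Rédei–Reichardt 4-rank criterion (lemmas R1, R2, R1″, R2″), Dirichlet/Legendre (DIR),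
and the norm-divisor lemma MU (`ε ≡ μ·γ²`, `γ⁴ ≡ μ` in `𝔽₉`).  The arithmetic inputs (class numbers, units) are NOT
formalised here.  This file kernel-checks the finite parts of the argument, where a slip is most likely:
(1) the model of `𝔽₉ = 𝔽₃[w̄]/(w̄²+1)` and lemma G-iii (`ε̄⁴ = N`, the three shapes of `ε̄²`);
(2) the Frobenius step of MU(iv): `γ^σ = γ³`, `N(γ) = γ⁴ ∈ {±1}`, and `μ ≡ 1 ⇒ ε̄ = ±1`, `μ ≡ 2 ⇒ ε̄ = ±w̄`;
(3) THEOREM 1 (ω ≥ 3) and THEOREM 2 (ω = 2, cases A–D) as finite implications: for EVERY assignment of the residues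
    (`U, V mod 3`, `e`, the sub-case `P ≡ Q′ (mod 4)`, `μ mod 3`, `h mod 8`, `h⁺ mod 8`) satisfying the conclusions of
    R1, R2, DIR, MU, the value `ε̄^(2h′) w̄^(h/2)` equals `1`;
(4) THEOREM 4 (even case: classes (β) m = 2, (γ) m = p, (δ) m = 2p) likewise, with the sign `(−1)^[m prime]`;
(5) the Kronecker symbols at 2 used in the C₄-splitting computations (residues mod 8);
(6) the hand-check rows `m′ = 1265, 8729, 2021, 221, 65` (residue data from redei_check.py / kgenus.py j184066).
All proofs are `decide`.
-/

set_option linter.dupNamespace false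

namespace Summit.HodgeConjecture.HodgeConjecture.HodgeLocus.Census.GKGenusAnchors

/-- `𝔽₉ = 𝔽₃[w̄]/(w̄² + 1)`, the pair `(x, y)` standing for `x + y·w̄`. -/
abbrev F9 := ZMod 3 × ZMod 3
/-- multiplication in `𝔽₉` (`w̄² = −1`). -/
def mul (p q : F9) : F9 := (p.1 * q.1 - p.2 * q.2, p.1 * q.2 + p.2 * q.1)
/-- `1 ∈ 𝔽₉`. -/
def one : F9 := (1, 0)
/-- `−1 ∈ 𝔽₉`. -/
def mone : F9 := (-1, 0)
/-- `w̄ ∈ 𝔽₉` (the image of `√m′`; `w̄² = −1` because `m′ ≡ 2 (mod 3)`). -/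
def w : F9 := (0, 1)
/-- `−w̄`. -/
def mw : F9 := (0, -1)
/-- powers in `𝔽₉`. -/
def npow (p : F9) : ℕ → F9
  | 0 => one
  | n + 1 => mul (npow p n) p
/-- Galois conjugation `x + y w̄ ↦ x − y w̄` (the non-trivial automorphism of `𝔽₉/𝔽₃`). -/
def conj (p : F9) : F9 := (p.1, -p.2)
/-- `ε̄ = −(U + V w̄)`, the image of `ε = (U + V√m′)/2` (`2⁻¹ = −1` in `𝔽₃`). -/
def epsbar (U V : ZMod 3) : F9 := (-U, -V)
/-- the norm sign read off `U² + V² ≡ N (mod 3)` (lemma G-iii): `true` = `N = −1`. -/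
def normNeg (U V : ZMod 3) : Bool := decide (U ^ 2 + V ^ 2 = (2 : ZMod 3))

/-- (1) `w̄² = −1`, `w̄` and `−w̄` have order 4. -/
theorem w_facts : npow w 2 = mone ∧ npow w 4 = one ∧ npow mw 2 = mone ∧ npow mw 4 = one ∧ npow w 1 ≠ one ∧ npow w 3 ≠ one := by decide

/-- (1) LEMMA G-iii.  For `(U, V) ≢ (0, 0)`: `U² + V² ∈ {1, 2}`; `N = −1` (i.e. `U² + V² ≡ 2`) iff `3 ∤ UV`, and then
`ε̄² = −UV·w̄`, `ε̄⁴ = −1` (order 8); `3 ∣ U ⇒ ε̄² = −1`; `3 ∣ V ⇒ ε̄² = 1`; in all cases `ε̄⁴ = N`. -/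
theorem G_iii : ∀ U V : ZMod 3, (U, V) ≠ (0, 0) →
    ((normNeg U V = true ↔ (U ≠ 0 ∧ V ≠ 0)) ∧
     (U ≠ 0 → V ≠ 0 → npow (epsbar U V) 2 = (0, -(U * V)) ∧ npow (epsbar U V) 4 = mone ∧ npow (epsbar U V) 8 = one) ∧
     (U = 0 → npow (epsbar U V) 2 = mone) ∧ (V = 0 → npow (epsbar U V) 2 = one) ∧
     (npow (epsbar U V) 4 = (if normNeg U V then mone else one))) := by decide

/-- (2) MU(iv), Frobenius step: conjugation on `𝔽₉` is the cube map, so `N(γ) = γ·γ^σ = γ⁴`, which lies in `{±1}`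
for `γ ≠ 0`; and with `ε̄ = μ̄·γ̄²`, `μ̄ = γ̄⁴`: `μ ≡ 1 ⇒ ε̄ = ±1` (so `3 ∣ V`), `μ ≡ 2 ⇒ ε̄ = ±w̄` (so `3 ∣ U`). -/
theorem MU_iv : ∀ g : F9, conj g = npow g 3 ∧ mul g (conj g) = npow g 4 ∧
    (g ≠ (0, 0) → (npow g 4 = one ∨ npow g 4 = mone) ∧
      (npow g 4 = one → (mul (npow g 4) (npow g 2) = one ∨ mul (npow g 4) (npow g 2) = mone)) ∧
      (npow g 4 = mone → (mul (npow g 4) (npow g 2) = w ∨ mul (npow g 4) (npow g 2) = mw))) := by decide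

/-- the K-CONG value `ε̄^(2h′)·w̄^(h/2)` from the residues `(U, V) mod 3`, `h′ mod 4`, `h mod 8` (odd `D`). -/
def val (U V : ZMod 3) (hp4 : ℕ) (h8 : ℕ) : F9 := mul (npow (epsbar U V) (2 * hp4)) (npow w (h8 / 2))
/-- `h′ mod 4` from `h⁺ mod 8` and the norm sign: `h′ = h⁺` if `N = −1`, `h⁺/2` if `N = +1`. -/
def hprime4 (nneg : Bool) (hplus8 : ℕ) : ℕ := if nneg then hplus8 % 4 else (hplus8 / 2) % 4

/-- (3) THEOREM 1 (ω(m′) ≥ 3) as a finite implication: `8 ∣ h` and `4 ∣ h⁺` force the value `1`, whatever the unit. -/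
theorem theorem1_logic : ∀ U V : ZMod 3, (U, V) ≠ (0, 0) → ∀ hplus8 : Fin 8, (hplus8 : ℕ) % 4 = 0 →
    val U V (hprime4 (normNeg U V) hplus8) 0 = one := by decide

set_option synthInstance.maxHeartbeats 800000 in
set_option synthInstance.maxSize 4096 in
/-- (3) THEOREM 2 (ω(m′) = 2, `m′ = P·Q′`) as a finite implication.  Inputs: `sub1` = [P ≡ Q′ ≡ 1 (mod 4)],
`e` = [(P/Q′) = +1], `(U, V) mod 3` (hence `N`), `mu3` = μ mod 3 (relevant when `N = +1`), `h mod 8 ∈ {0, 4}` (4 ∣ h),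
`h⁺ mod 8` even (2 ∣ h⁺).  Hypotheses = the conclusions of R1 (`8 ∣ h ↔ e`), R2 (`4 ∣ h⁺ ↔ sub1 ∧ e`),
DIR (`sub1 ∧ ¬e → N = −1`; `¬sub1 → N = +1`), MU(iv) (`N = +1 → (3 ∣ U ↔ μ ≡ 2) ∧ (3 ∣ V ↔ μ ≡ 1)`),
MU(v) (`¬sub1 → (μ ≡ 1 ↔ e)`).  Conclusion: the K-CONG value is `1`.  (4608 assignments, checked by `decide`.) -/
theorem theorem2_logic : ∀ (sub1 e : Bool) (U V : ZMod 3) (mu3 : Fin 2) (hh : Fin 2) (hplus8 : Fin 8),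
    (U, V) ≠ (0, 0) → (hplus8 : ℕ) % 2 = 0 →
    -- h mod 8 = 4 * hh ;  mu mod 3 = mu3 + 1
    (((4 * (hh : ℕ)) = 0) ↔ e = true) →                                   -- R1
    (((hplus8 : ℕ) % 4 = 0) ↔ (sub1 = true ∧ e = true)) →                  -- R2
    ((sub1 = true ∧ e = false) → normNeg U V = true) →                      -- DIR (i)
    (sub1 = false → normNeg U V = false) →                                  -- DIR (ii)
    (normNeg U V = false → ((U = 0 ↔ (mu3 : ℕ) + 1 = 2) ∧ (V = 0 ↔ (mu3 : ℕ) + 1 = 1))) →   -- MU(iv)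
    ((sub1 = false) → (((mu3 : ℕ) + 1 = 1) ↔ e = true)) →                  -- MU(v)
    val U V (hprime4 (normNeg U V) hplus8) (4 * hh) = one := by decide

/-- the even-case value `ε̄^(2h′)·(−w̄)^(h/2)` with `ε̄ = a + b w̄`. -/
def valE (a b : ZMod 3) (hp4 : ℕ) (h8 : ℕ) : F9 := mul (npow (a, b) (2 * hp4)) (npow mw (h8 / 2))

/-- (4) THEOREM 4 (β): `m = 2`, `ε = 1 + √2` (`a = b = 1`, `N = −1`), `h(−24) = 2`, `h(8) = 1`: value `−1`. -/
theorem theorem4_beta : valE 1 1 1 2 = mone := by decide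

/-- (4) THEOREM 4 (α): rk₂ ≥ 3 (`8 ∣ h`, `4 ∣ h⁺`): value `+1` (same computation as Theorem 1, with `−w̄`). -/
theorem theorem4_alpha : ∀ a b : ZMod 3, (a, b) ≠ (0, 0) → ∀ hplus8 : Fin 8, (hplus8 : ℕ) % 4 = 0 →
    valE a b (hprime4 (normNeg a b) hplus8) 0 = one := by decide

/-- (4) THEOREM 4 (γ): `m = p ≡ 11 (mod 12)` prime, `r7` = [p ≡ 7 (mod 8)] (else p ≡ 3 (mod 8)); hypotheses:
`N = +1`, `h′` odd, `8 ∣ h ↔ r7` (R1 for −12p), `μ ≡ 2 ↔ r7` (EMU: μ = 2 or 2p), MU(iv).  Conclusion: value `−1`. -/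
theorem theorem4_gamma : ∀ (r7 : Bool) (a b : ZMod 3) (mu3 : Fin 2) (hh : Fin 2) (hp4 : Fin 4),
    (a, b) ≠ (0, 0) → normNeg a b = false → (hp4 : ℕ) % 2 = 1 →
    (((4 * (hh : ℕ)) = 0) ↔ r7 = true) →
    (((mu3 : ℕ) + 1 = 2) ↔ r7 = true) →
    ((a = 0 ↔ (mu3 : ℕ) + 1 = 2) ∧ (b = 0 ↔ (mu3 : ℕ) + 1 = 1)) →
    valE a b hp4 (4 * hh) = mone := by decide

set_option synthInstance.maxHeartbeats 800000 in
set_option synthInstance.maxSize 4096 in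
/-- (4) THEOREM 4 (δ): `m = 2p`, `p ≡ 1 (mod 3)`, `r8 = p mod 8 ∈ {1,3,5,7}`; hypotheses = R1″ (`8 ∣ h ↔ r8 ∈ {1,3}`),
R2″ (`4 ∣ h⁺ ↔ r8 = 1`), DIR″ (`r8 = 5 → N = −1`; `r8 ∈ {3,7} → N = +1`), EMU″ (`N = +1 ∧ r8 = 3 → μ ≡ 1`;
`N = +1 ∧ r8 = 7 → μ ≡ 2`), MU(iv).  Conclusion: value `+1`. -/
theorem theorem4_delta : ∀ (r8 : Fin 8) (a b : ZMod 3) (mu3 : Fin 2) (hh : Fin 2) (hplus8 : Fin 8),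
    (r8 : ℕ) % 2 = 1 → (a, b) ≠ (0, 0) → (hplus8 : ℕ) % 2 = 0 →
    (((4 * (hh : ℕ)) = 0) ↔ ((r8 : ℕ) = 1 ∨ (r8 : ℕ) = 3)) →
    (((hplus8 : ℕ) % 4 = 0) ↔ (r8 : ℕ) = 1) →
    ((r8 : ℕ) = 5 → normNeg a b = true) → (((r8 : ℕ) = 3 ∨ (r8 : ℕ) = 7) → normNeg a b = false) →
    ((normNeg a b = false ∧ (r8 : ℕ) = 3) → (mu3 : ℕ) + 1 = 1) → ((normNeg a b = false ∧ (r8 : ℕ) = 7) → (mu3 : ℕ) + 1 = 2) →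
    (normNeg a b = false → ((a = 0 ↔ (mu3 : ℕ) + 1 = 2) ∧ (b = 0 ↔ (mu3 : ℕ) + 1 = 1))) →
    valE a b (hprime4 (normNeg a b) hplus8) (4 * hh) = one := by decide

/-- the Kronecker symbol `(n/2)` (`+1` for `n ≡ ±1 (mod 8)`, `−1` for `n ≡ ±3 (mod 8)`, `0` for even `n`). -/
def kron2 (n : ℤ) : ℤ := if n % 8 = 1 ∨ n % 8 = 7 then 1 else if n % 8 = 3 ∨ n % 8 = 5 then -1 else 0

/-- (5) the symbols at 2 in the C₄-splittings of §5r(k): for `p ≡ 3 (mod 4)`: `(−p/2) = +1 ↔ p ≡ 7 (8)` and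
`(3p/2) = +1 ↔ p ≡ 3 (8)`; for `p ≡ 1 (mod 4)`: `(p/2) = +1 ↔ p ≡ 1 (8)`; and `(−3/2) = −1`, `(−8 ≡ 1 (mod 3))`,
`(12 ≡ 0)`: `(−24) ≡ 0 (mod 8)` bookkeeping: `(−3) % 8 = 5`. -/
theorem kron2_facts : (∀ r : Fin 8, ((r : ℕ) % 4 = 3) →
      ((kron2 (-(r : ℤ)) = 1 ↔ (r : ℕ) = 7) ∧ (kron2 (3 * (r : ℤ)) = 1 ↔ (r : ℕ) = 3))) ∧
    (∀ r : Fin 8, ((r : ℕ) % 4 = 1) → (kron2 (r : ℤ) = 1 ↔ (r : ℕ) = 1)) ∧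
    kron2 (-3) = -1 ∧ ((-8 : ℤ) % 3 = 1) ∧ ((-3 : ℤ) % 8 = 5) := by decide

/-- (6) the hand-check rows (PREREG §K-GENUS ERRATUM; residues recomputed with redei_check.py + imag_h.py, and equal to
the kgenus.py rows of j184066): `m′ = 1265 = 5·11·23` (U ≡ 1, V ≡ 0, N = +1, μ = 115, h = 16, h⁺ = 4, h′ = 2),
`8729 = 7·29·43` (U ≡ 0, V ≡ 1, N = +1, μ = 1247 ≡ 2, h = 24, h⁺ = 4, h′ = 2 — the row refuting the withdrawn (R3)),
`2021 = 43·47` (case D: U ≡ 0, V ≡ 1, N = +1, μ = 47, h = 36, h⁺ = 6, h′ = 3), `221 = 13·17` (case A: U ≡ 0, V ≡ 1,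
N = +1, μ = 17, h = 16, h⁺ = 4, h′ = 2), `65 = 5·13` (case B: U ≡ 1, V ≡ 2, N = −1, h = 4, h⁺ = h′ = 2):
the K-CONG value `ε̄^(2h′) w̄^(h/2)` is `1` on each. -/
theorem handcheck_rows : val 1 0 2 (16 % 8) = one ∧ val 0 1 2 (24 % 8) = one ∧ val 0 1 3 (36 % 8) = one ∧
    val 0 1 2 (16 % 8) = one ∧ val 1 2 2 (4 % 8) = one := by decide

end Summit.HodgeConjecture.HodgeConjecture.HodgeLocus.Census.GKGenusAnchors
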